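import Mathlib
import Literature.Combinatorics.Optimization.RandomGapGraphs
import Literature.Combinatorics.Optimization.MaxTwoLinSheraliAdamsGap
import Literature.Combinatorics.Optimization.RandomUniqueGamesSoundness
import HarnessLib

/-!
# The Charikar–Makarychev–Makarychev Sherali–Adams gap for Unique Games (CMM09 Theorem 6.1),
# DISCHARGED: `CharikarMakarychevMakarychev2009_uniqueGamesSA_holds`

[topic Combinatorics/Optimization]

`UniqueGamesLpHardness.lean` vendored CMM09 Theorem 6.1 — "Fix a number of labels `q = 2^t`, a real
`δ ∈ (0, 1)` and let `∆ = ⌈C(q/δ)²⌉` (for a sufficiently large constant `C`). Then for every positive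
`ε` there exists `γ` depending on `ε` such that for every sufficiently large `n` there exists an instance
of Unique Games on `∆`-regular graph `G` on `n` vertices so that (i) The cost of the optimal solution is
at most `1/q · (1 + δ)`. (ii) There exists a solution to the LP relaxation obtained after `r = n^γ`
rounds of Sherali–Adams of cost `(1 − ε)`" (p. 13) — as the named fact
`CharikarMakarychevMakarychev2009_uniqueGamesSA` (in the Lee–Raghavendra–Steurer pseudo-density
currency), from which LRS Thm 7.6 / Cor 7.7 were proved.  Its proof sketch (p. 13) has three steps,
all of them now theorems of the tree:

1. random signs make every labelling poor — `RandomUniqueGamesSoundness.lean`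
   (`CharikarMakarychevMakarychev2009_uniqueGamesSA_of_twoLinAllSigns` reduces the fact to MAX 2LIN(2)
   Sherali–Adams solutions good for EVERY sign pattern on one dense graph sequence);
2. the `t` coordinates are independent MAX 2LIN instances — `UniqueGamesFromTwoLin.lean`;
3. "Theorem 5.3 works not only for MAX CUT, but also for MAX 2LIN" — `MaxTwoLinSheraliAdamsGap.lean`
   (`Multicut.exists_pseudoDensity_twoLin_of_gapGraph`, pointwise in the parameters).

This file supplies the graphs and the parameters and closes the fact:

* `RandomPairs.exists_gapGraphs_girth` — the CMM/ABLT gap graphs of `RandomGapGraphs.exists_gapGraphs`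
  with the two extra properties the signed argument consumes, both established inside that construction:
  every cycle is longer than the path-decomposition length `⌊c log n⌋` (`girth_pruned`: "Deleting an
  edge from each of these cycles then gives a graph of girth at least `g`", [ABLT06] Lemma 2.8), and
  `|E| ≥ ∆₀ n` for any requested `∆₀` (`λ ≥ 2∆₀` random pairs per vertex; "`∆ = ⌈C(q/δ)²⌉` for a
  sufficiently large constant `C`", CMM09 Thm 6.1);
* `twoLinAllSigns_of_gapGraphs` — the parameter choice of CMM09 Thm 5.3 (p. 11; verbatim the one of
  `maxCutSA_of_gapGraphs`: `µ = ε₁³/40`, `L = ⌊c′ log n⌋/9`, `d = ⌊n^γ⌋`, `γ = µc′/18`) feeding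
  `exists_pseudoDensity_twoLin_of_gapGraph` for every sign pattern on the enumerated edges;
* **`CharikarMakarychevMakarychev2009_uniqueGamesSA_holds`** — the discharge; hence LRS Thm 7.6 and
  Cor 7.7 hold unconditionally (`LeeRaghavendraSteurer2015_thm76_holds`, `_thm76_literal_holds`,
  `LeeRaghavendraSteurer2015_cor77_holds`).

Everything is proved; no named facts; no `sorry`.

## References

* [CharikarMakarychevMakarychev2009] M. Charikar, K. Makarychev, Y. Makarychev, *Integrality gaps for
  Sherali–Adams relaxations*, STOC 2009, doi:10.1145/1536414.1536455; Thm 5.3 (p. 11), Thm 6.1 and its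
  proof sketch (p. 13).  Held text `paper:doi-10-1145-1536414-1536455`.
* [AroraBollobasLovaszTourlakis2006] S. Arora, B. Bollobás, L. Lovász, I. Tourlakis, *Proving
  integrality gaps without knowing the linear program*, Theory of Computing 2 (2006), Lemma 2.8
  (p. 26–27), Lemma 2.12.
* [LeeRaghavendraSteurer2015] J. R. Lee, P. Raghavendra, D. Steurer, *Lower bounds on the size of
  semidefinite programming relaxations*, STOC 2015 / arXiv:1411.6317, Thm 7.6 and Cor 7.7 (arXiv p. 29).
-/

noncomputable section

open Finset Real Filter Topology

namespace Literature.Combinatorics.Optimization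

namespace RandomPairs

variable {n M : ℕ}

set_option maxHeartbeats 800000 in
/-- **The CMM gap graphs, with girth and density exported.**  For every `∆₀` and `ε > 0` there are
`∆`, `c > 0` and `n₀` such that for all `n ≥ n₀` some loopless nonempty edge set `E` on `n` vertices
has maximum degree `≤ ∆`, all cuts `≤ (1/2+ε)|E|`, all sub-edge-sets on `≤ √n` vertices
`⌊c log n⌋`-path decomposable, every cycle longer than `⌊c log n⌋`, and `|E| ≥ ∆₀ n`.  Same
construction and proof as `exists_gapGraphs` with `λ = ⌈16/ε₁²⌉ + 2∆₀` random pairs per vertex; the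
girth is `girth_pruned`, the size bound is `|E| ≥ (1 − ε₁/16)λn`.
[cite: CharikarMakarychevMakarychev2009, §5 (p. 10–11) and Thm 6.1 (p. 13); AroraBollobasLovaszTourlakis2006, Lemma 2.8 (p. 26–27: "Deleting an edge from each of these cycles then gives a graph of girth at least g") and Lemma 2.12] -/
theorem exists_gapGraphs_girth (Δ₀ : ℕ) :
    ∀ ε : ℝ, 0 < ε → ∃ Δ : ℕ, ∃ c : ℝ, 0 < c ∧ ∃ n₀ : ℕ, ∀ n : ℕ, n₀ ≤ n →
      ∃ E : Finset (Sym2 (Fin n)), E.Nonempty ∧ (∀ e ∈ E, ¬ e.IsDiag) ∧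
        (∀ v : Fin n, (E.filter fun e => v ∈ e).card ≤ Δ) ∧
        (∀ x : Fin n → Bool, ∑ e ∈ E, cutFn e x ≤ (1 / 2 + ε) * E.card) ∧
        (∀ E' ⊆ E, ((Multicut.supp E').card : ℝ) ^ 2 ≤ n →
          Multicut.PathDecomposable ⌊c * Real.log n⌋₊ E') ∧
        (∀ (u : Fin n) (w : (Multicut.gr E).Walk u u), w.IsCycle → ⌊c * Real.log n⌋₊ + 1 ≤ w.length) ∧
        Δ₀ * n ≤ E.card := by
  intro ε hε
  -- constants
  set ε₁ : ℝ := min ε 1 with hε₁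
  have hε₁0 : 0 < ε₁ := lt_min hε one_pos
  have hε₁1 : ε₁ ≤ 1 := min_le_right _ _
  have hε₁ε : ε₁ ≤ ε := min_le_left _ _
  set lam : ℕ := ⌈16 / ε₁ ^ 2⌉₊ + 2 * Δ₀ with hlamdef
  have hlamΔ₀ : 2 * Δ₀ ≤ lam := by rw [hlamdef]; omega
  have hlam16 : 16 ≤ ε₁ ^ 2 * lam := by
    have h : 16 / ε₁ ^ 2 ≤ (lam : ℝ) := by
      refine (Nat.le_ceil _).trans ?_
      rw [hlamdef]; push_cast; linarith [(Nat.cast_nonneg (2 * Δ₀ : ℕ) : (0:ℝ) ≤ ((2 * Δ₀ : ℕ) : ℝ))]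
    have hε2 : 0 < ε₁ ^ 2 := by positivity
    calc (16 : ℝ) = ε₁ ^ 2 * (16 / ε₁ ^ 2) := by field_simp
      _ ≤ ε₁ ^ 2 * lam := mul_le_mul_of_nonneg_left h hε2.le
  have hlam1r : (1 : ℝ) ≤ lam := by
    have h1 : ε₁ ^ 2 ≤ 1 := by nlinarith
    have h2 : ε₁ ^ 2 * lam ≤ 1 * lam := mul_le_mul_of_nonneg_right h1 (Nat.cast_nonneg _)
    linarith
  have hlam : 1 ≤ lam := by exact_mod_cast hlam1r
  have hlam0 : (0 : ℝ) < lam := by linarith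
  set D : ℕ := ⌈512 * (2 + 4 * (lam : ℝ)) / ε₁⌉₊ + 1 with hDdef
  have hD : 512 * (2 + 4 * (lam : ℝ)) ≤ D * ε₁ := by
    have h : 512 * (2 + 4 * (lam : ℝ)) / ε₁ ≤ (⌈512 * (2 + 4 * (lam : ℝ)) / ε₁⌉₊ : ℝ) := Nat.le_ceil _
    have h' : (⌈512 * (2 + 4 * (lam : ℝ)) / ε₁⌉₊ : ℝ) ≤ D := by rw [hDdef]; push_cast; linarith
    calc 512 * (2 + 4 * (lam : ℝ)) = 512 * (2 + 4 * (lam : ℝ)) / ε₁ * ε₁ := by field_simp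
      _ ≤ D * ε₁ := mul_le_mul_of_nonneg_right (h.trans h') hε₁0.le
  have hD1 : 1 ≤ D := by rw [hDdef]; omega
  set Bc : ℝ := exp 1 ^ 2 * lam with hBc
  set A : ℝ := Real.log (16 * Bc * (exp 1 * lam)) with hA
  have he1 : 1 ≤ exp (1 : ℝ) := by have := Real.add_one_le_exp (1:ℝ); linarith
  have helam : 1 ≤ exp 1 * (lam : ℝ) := by nlinarith
  have hBc1 : 1 ≤ Bc := by rw [hBc]; nlinarith
  have hA0 : 0 ≤ A := by rw [hA]; exact Real.log_nonneg (by nlinarith)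
  have hA2lam : Real.log (2 * lam) ≤ A := by
    rw [hA]; refine Real.log_le_log (by positivity) ?_; nlinarith
  set c : ℝ := 1 / (24 * (A + 1)) with hc
  have hc0 : 0 < c := by rw [hc]; positivity
  have hc1 : c ≤ 1 := by rw [hc, div_le_one (by positivity)]; linarith
  have hcA : c * Real.log (2 * lam) ≤ 1 / 4 := by
    calc c * Real.log (2 * lam) ≤ c * A := mul_le_mul_of_nonneg_left hA2lam hc0.le
      _ = A / (24 * (A + 1)) := by rw [hc]; ring
      _ ≤ 1 / 4 := by rw [div_le_div_iff₀ (by positivity) (by norm_num)]; linarith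
  refine ⟨D, c, hc0, ?_⟩
  -- eventual conditions in `n`
  have hnat : Tendsto (fun k : ℕ => (k : ℝ)) atTop atTop := tendsto_natCast_atTop_atTop
  have hlog : Tendsto (fun k : ℕ => Real.log (k : ℝ)) atTop atTop := Real.tendsto_log_atTop.comp hnat
  have ev1 : ∀ᶠ k : ℕ in atTop, 2 ≤ k := eventually_ge_atTop 2
  have ev2 : ∀ᶠ k : ℕ in atTop, 32 * (8 * (lam : ℝ) + 16 * lam ^ 2) / (ε₁ * lam) ≤ (k : ℝ) :=
    hnat.eventually_ge_atTop _
  have ev3 : ∀ᶠ k : ℕ in atTop, (41472 / (ε₁ * lam)) ^ 2 ≤ (k : ℝ) := hnat.eventually_ge_atTop _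
  have ev4 : ∀ᶠ k : ℕ in atTop, (exp 1 * lam) ^ 2 ≤ (k : ℝ) := hnat.eventually_ge_atTop _
  have ev5 : ∀ᶠ k : ℕ in atTop, 56 * A ≤ Real.log (k : ℝ) := hlog.eventually_ge_atTop _
  obtain ⟨n₀, hn₀⟩ := eventually_atTop.1 (ev1.and (ev2.and (ev3.and (ev4.and ev5))))
  refine ⟨n₀, fun n hn => ?_⟩
  obtain ⟨h2n, h2, h3, h4, h5⟩ := hn₀ n hn
  have hn1 : 1 ≤ n := by omega
  have hnpos : (0 : ℝ) < n := by exact_mod_cast (by omega : 0 < n)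
  have hn1r : (1 : ℝ) ≤ n := by exact_mod_cast hn1
  have hlogn0 : 0 ≤ Real.log n := Real.log_nonneg hn1r
  -- `n`-dependent parameters
  set l : ℕ := ⌊c * Real.log n⌋₊ with hl
  set η : ℝ := 1 / (6 * l + 14) with hη
  set K : ℕ := ⌊Real.sqrt n⌋₊ with hK
  have hη0 : 0 ≤ η := by rw [hη]; positivity
  have hη1 : η ≤ 1 := by rw [hη, div_le_one (by positivity)]; have : (0:ℝ) ≤ l := Nat.cast_nonneg _; linarith
  have hlle : (l : ℝ) ≤ c * Real.log n := Nat.floor_le (mul_nonneg hc0.le hlogn0)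
  have hsqrtpos : 0 < Real.sqrt n := Real.sqrt_pos.2 hnpos
  have hsq : Real.sqrt n * Real.sqrt n = n := Real.mul_self_sqrt hnpos.le
  -- (a) `eλ ≤ √n`
  have hρ : exp 1 * lam ≤ Real.sqrt n := (Real.le_sqrt (by positivity) hnpos.le).2 h4
  -- (b) `32(8λ+16λ²) ≤ ε₁ λ n`
  have hsmall : 32 * (8 * (lam : ℝ) + 16 * lam ^ 2) ≤ ε₁ * ((lam * n : ℕ) : ℝ) := by
    push_cast
    have := (div_le_iff₀ (by positivity : (0:ℝ) < ε₁ * lam)).1 h2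
    linarith
  -- (c) `512 (l+1)² (2λ)^l ≤ ε₁ λ n`
  have hcyc : 512 * ((l : ℝ) + 1) ^ 2 * (2 * lam) ^ l ≤ ε₁ * lam * n := by
    -- `(l+1)² ≤ 81 n^{1/4}`
    have hn8 : 1 ≤ (n : ℝ) ^ (1 / 8 : ℝ) := Real.one_le_rpow hn1r (by norm_num)
    have hlog8 : Real.log n ≤ 8 * (n : ℝ) ^ (1 / 8 : ℝ) := by
      have := Real.log_le_rpow_div hnpos.le (by norm_num : (0:ℝ) < 1 / 8)
      linarith [show (n : ℝ) ^ (1 / 8 : ℝ) / (1 / 8) = 8 * (n : ℝ) ^ (1 / 8 : ℝ) by ring]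
    have hl1 : (l : ℝ) + 1 ≤ 9 * (n : ℝ) ^ (1 / 8 : ℝ) := by
      have : (l : ℝ) ≤ Real.log n := hlle.trans (mul_le_of_le_one_left hlogn0 hc1)
      linarith
    have hsq8 : ((n : ℝ) ^ (1 / 8 : ℝ)) ^ 2 = (n : ℝ) ^ (1 / 4 : ℝ) := by
      rw [← Real.rpow_natCast, ← Real.rpow_mul hnpos.le]; norm_num
    have hA1 : ((l : ℝ) + 1) ^ 2 ≤ 81 * (n : ℝ) ^ (1 / 4 : ℝ) := by
      calc ((l : ℝ) + 1) ^ 2 ≤ (9 * (n : ℝ) ^ (1 / 8 : ℝ)) ^ 2 :=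
            pow_le_pow_left₀ (by positivity) hl1 2
        _ = 81 * (n : ℝ) ^ (1 / 4 : ℝ) := by rw [mul_pow, hsq8]; norm_num
    -- `(2λ)^l ≤ n^{1/4}`
    have h2lam : (1 : ℝ) ≤ 2 * lam := by linarith
    have hB1 : (2 * (lam : ℝ)) ^ l ≤ (n : ℝ) ^ (1 / 4 : ℝ) := by
      calc (2 * (lam : ℝ)) ^ l = (2 * (lam : ℝ)) ^ ((l : ℕ) : ℝ) := (Real.rpow_natCast _ _).symm
        _ ≤ (2 * (lam : ℝ)) ^ (c * Real.log n) := Real.rpow_le_rpow_of_exponent_le h2lam hlle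
        _ = Real.exp (c * Real.log n * Real.log (2 * lam)) := by
            rw [Real.rpow_def_of_pos (by positivity), mul_comm]
        _ ≤ Real.exp (Real.log n * (1 / 4)) := by
            rw [Real.exp_le_exp]
            have : c * Real.log n * Real.log (2 * lam) = Real.log n * (c * Real.log (2 * lam)) := by ring
            rw [this]
            exact mul_le_mul_of_nonneg_left hcA hlogn0
        _ = (n : ℝ) ^ (1 / 4 : ℝ) := by rw [Real.rpow_def_of_pos hnpos]
    have hquarter : (n : ℝ) ^ (1 / 4 : ℝ) * (n : ℝ) ^ (1 / 4 : ℝ) = Real.sqrt n := by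
      rw [← Real.rpow_add hnpos, Real.sqrt_eq_rpow]; norm_num
    -- `√n ≥ 41472/(ε₁ λ)`
    have hsqrtge : 41472 / (ε₁ * lam) ≤ Real.sqrt n := (Real.le_sqrt (by positivity) hnpos.le).2 h3
    have h41472 : 41472 * Real.sqrt n ≤ ε₁ * lam * n := by
      have := (div_le_iff₀ (by positivity : (0:ℝ) < ε₁ * lam)).1 hsqrtge
      calc 41472 * Real.sqrt n ≤ (Real.sqrt n * (ε₁ * lam)) * Real.sqrt n :=
            mul_le_mul_of_nonneg_right this hsqrtpos.le
        _ = ε₁ * lam * n := by rw [mul_comm (Real.sqrt n), mul_assoc, hsq]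
    calc 512 * ((l : ℝ) + 1) ^ 2 * (2 * lam) ^ l ≤ 512 * (81 * (n : ℝ) ^ (1 / 4 : ℝ)) * (n : ℝ) ^ (1 / 4 : ℝ) := by
          gcongr
      _ = 41472 * Real.sqrt n := by rw [← hquarter]; ring
      _ ≤ ε₁ * lam * n := h41472
  -- (d) `l ≤ M`
  have hlog_le : c * Real.log n ≤ Real.log n := mul_le_of_le_one_left hlogn0 hc1
  have hlM : l ≤ lam * n := by
    have h1 : (l : ℝ) ≤ Real.log n := hlle.trans hlog_le
    have h2 : Real.log n ≤ n := (Real.log_le_sub_one_of_pos hnpos).trans (by linarith)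
    have h3 : (n : ℝ) ≤ lam * n := le_mul_of_one_le_left hnpos.le hlam1r
    exact_mod_cast (h1.trans (h2.trans h3))
  -- (e) the density decay: `e²λ ρ^η ≤ 1/16`
  have hdecay : exp 1 ^ 2 * lam * (exp 1 * lam / Real.sqrt n) ^ η ≤ 1 / 16 := by
    have hρpos : 0 < exp 1 * lam / Real.sqrt n := by positivity
    -- `(η/2) log n ≥ A`
    have hηlog : A ≤ η / 2 * Real.log n := by
      -- `log n ≥ 2A(6 c log n + 14)` from `log n ≥ 56A` and `12Ac ≤ 1/2`
      have h12 : 12 * A * c ≤ 1 / 2 := by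
        have hA1 : (0 : ℝ) < A + 1 := by linarith
        rw [hc, show 12 * A * (1 / (24 * (A + 1))) = A / (2 * (A + 1)) by field_simp; ring]
        rw [div_le_iff₀ (by positivity)]; linarith
      have hkey : 2 * A * (6 * c * Real.log n + 14) ≤ Real.log n := by
        have h' : 12 * A * c * Real.log n ≤ 1 / 2 * Real.log n := mul_le_mul_of_nonneg_right h12 hlogn0
        have e : 2 * A * (6 * c * Real.log n + 14) = 12 * A * c * Real.log n + 28 * A := by ring
        rw [e]; linarith
      have hden : (0 : ℝ) < 6 * l + 14 := by positivity
      rw [hη]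
      rw [show 1 / (6 * (l : ℝ) + 14) / 2 * Real.log n = Real.log n / (2 * (6 * l + 14)) by
        field_simp]
      rw [le_div_iff₀ (by positivity)]
      calc A * (2 * (6 * (l : ℝ) + 14)) ≤ A * (2 * (6 * (c * Real.log n) + 14)) := by
            gcongr
        _ = 2 * A * (6 * c * Real.log n + 14) := by ring
        _ ≤ Real.log n := hkey
    -- `e²λ ρ^η = exp(log(e²λ) + η log ρ)` and `log ρ = log(eλ) − (log n)/2`
    have hlogρ : Real.log (exp 1 * lam / Real.sqrt n) = Real.log (exp 1 * lam) - Real.log n / 2 := by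
      rw [Real.log_div (by positivity) hsqrtpos.ne', Real.log_sqrt hnpos.le]
    have hexpr : exp 1 ^ 2 * lam * (exp 1 * lam / Real.sqrt n) ^ η =
        Real.exp (Real.log Bc + (Real.log (exp 1 * lam) - Real.log n / 2) * η) := by
      rw [Real.exp_add, Real.exp_log (by positivity), Real.rpow_def_of_pos hρpos, hlogρ, ← hBc]
    rw [hexpr]
    have h16 : (1 / 16 : ℝ) = Real.exp (-Real.log 16) := by rw [Real.exp_neg, Real.exp_log (by norm_num)]; norm_num
    rw [h16, Real.exp_le_exp]
    -- `log Bc + η log(eλ) − (η/2) log n ≤ −log 16` since `A = log 16 + log Bc + log(eλ) ≤ (η/2) log n`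
    have hAexp : A = Real.log 16 + Real.log Bc + Real.log (exp 1 * lam) := by
      rw [hA, Real.log_mul (by positivity) (by positivity), Real.log_mul (by norm_num) (by positivity)]
    have hlogel : 0 ≤ Real.log (exp 1 * lam) := Real.log_nonneg helam
    have : η * Real.log (exp 1 * lam) ≤ Real.log (exp 1 * lam) := mul_le_of_le_one_left hlogel hη1
    have e : Real.log Bc + (Real.log (exp 1 * lam) - Real.log n / 2) * η =
        Real.log Bc + η * Real.log (exp 1 * lam) - η / 2 * Real.log n := by ring
    rw [e]; linarith
  -- the good outcome and its pruned edge set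
  have hKle : (K : ℝ) ≤ Real.sqrt n := Nat.floor_le hsqrtpos.le
  have hdense := dense_sum_le (M := lam * n) (K := K) hη0 rfl hn1 hlam hρ hKle hdecay
  obtain ⟨ω, hω⟩ := exists_good (n := n) (M := lam * n) (K := K) (η := η) (D := D) (l := l)
    hε₁0 h2n rfl hlam hlam16 hD hcyc hlM hdense
  obtain ⟨hne, hloop, hdeg, hcut, hPD⟩ := good_props (ε := ε) hε₁0 hε₁1 hε₁ε rfl hn1 hlam hD1 hsmall hη
    (by rw [hK]) hω
  refine ⟨pruned D l ω, hne, hloop, hdeg, hcut, hPD, girth_pruned D l ω, ?_⟩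
  -- the density: `|E| ≥ (1 − ε₁/16) λ n ≥ Δ₀ n`
  have hω' := hω
  obtain ⟨-, hloops, hreps, hhigh, hcycs, -⟩ := hω'
  have hsize : (1 - ε₁ / 16) * ((lam * n : ℕ) : ℝ) ≤ ((pruned D l ω).card : ℝ) := by
    have h := le_card_pruned_add (n := n) (M := lam * n) D l ω
    have h' : ((lam * n : ℕ) : ℝ) ≤ ((pruned D l ω).card : ℝ) + loopCount ω + highInc D ω +
        (cycIdx l ω).card + repCount ω := by exact_mod_cast h
    nlinarith
  have hΔ₀r : ((Δ₀ * n : ℕ) : ℝ) ≤ (1 - ε₁ / 16) * ((lam * n : ℕ) : ℝ) := by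
    push_cast
    have h1 : (2 * Δ₀ : ℝ) ≤ lam := by exact_mod_cast hlamΔ₀
    have h2 : (15 / 16 : ℝ) ≤ 1 - ε₁ / 16 := by linarith
    have h3 : (Δ₀ : ℝ) * n ≤ (15 / 16) * (lam * n) := by nlinarith
    calc (Δ₀ : ℝ) * n ≤ (15 / 16) * (lam * n) := h3
      _ ≤ (1 - ε₁ / 16) * (lam * n) := mul_le_mul_of_nonneg_right h2 (by positivity)
  exact_mod_cast hΔ₀r.trans hsize

end RandomPairs

/-! ### Parameters, edge enumeration, and the discharge -/

section Assembly

open Multicut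

/-- **The MAX 2LIN(2) Sherali–Adams solutions for all sign patterns on the gap graphs** (the
hypothesis of `CharikarMakarychevMakarychev2009_uniqueGamesSA_of_twoLinAllSigns`): for every `∆₀` and
`ε > 0` there is `γ > 0` such that for all large `n` the (enumerated, oriented) edges `(u_i, v_i)_{i<M}`
of a gap graph with `M ≥ ∆₀ n` admit, for EVERY sign pattern `σ ∈ {0,1}^M`, an `⌊n^γ⌋`-local
pseudo-density under which each equation `x_{v_i} = x_{u_i} ⊕ σ_i` has pseudo-probability `≥ 1 − ε`.
Parameters as in CMM09 Thm 5.3 / `maxCutSA_of_gapGraphs`.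
[cite: CharikarMakarychevMakarychev2009, Thm 5.3 (p. 11) and Thm 6.1 proof (p. 13)] -/
theorem twoLinAllSigns_of_gapGraphs :
    ∀ t : ℕ, 1 ≤ t → ∀ Δ₀ : ℕ, ∀ ε : ℝ, 0 < ε →
      ∃ γ : ℝ, 0 < γ ∧ ∃ n₀ : ℕ, ∀ n : ℕ, n₀ ≤ n →
        ∃ (M : ℕ) (_ : 0 < M) (u v : Fin M → Fin n) (_ : ∀ i, u i ≠ v i), Δ₀ * n ≤ M ∧
          ∀ σ : Fin M → Bool, ∃ D : (Fin n → Bool) → ℝ,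
            IsLocalPseudoDensity (uniformWeight (Fin n) Bool) ⌊(n : ℝ) ^ γ⌋₊ D ∧
            ∀ i, 1 - ε ≤ muExpect (uniformWeight (Fin n) Bool)
              (fun y => D y * (if y (v i) = xor (y (u i)) (σ i) then (1 : ℝ) else 0)) := by
  intro t _ Δ₀ ε hε
  -- parameters independent of `n`
  set ε₁ : ℝ := min (ε / 2) (1 / 2) with hε₁
  have hε₁0 : 0 < ε₁ := lt_min (by linarith) (by norm_num)
  have hε₁ε : ε₁ < ε := lt_of_le_of_lt (min_le_left _ _) (by linarith)
  have hε₁1 : ε₁ ≤ 1 / 2 := min_le_right _ _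
  set μ : ℝ := ε₁ ^ 3 / 40 with hμ
  have hμ0 : 0 < μ := by rw [hμ]; positivity
  have hμ1 : μ ≤ 1 := by
    rw [hμ]; have : ε₁ ^ 3 ≤ (1 / 2) ^ 3 := pow_le_pow_left₀ hε₁0.le hε₁1 3
    linarith
  have hμε : 40 * μ ≤ ε₁ ^ 3 := by rw [hμ]; linarith
  obtain ⟨Δ, c, hc, n₀, hgraphs⟩ := RandomPairs.exists_gapGraphs_girth Δ₀ ε hε
  set c' : ℝ := min c (1 / (4 * Real.log (Δ + 2))) with hc'
  have hlog2 : 0 < Real.log ((Δ : ℝ) + 2) := Real.log_pos (by have := Nat.cast_nonneg (α := ℝ) Δ; linarith)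
  have hc'0 : 0 < c' := lt_min hc (by positivity)
  have hc'c : c' ≤ c := min_le_left _ _
  have hcΔ : c' * Real.log (Δ + 2) ≤ 1 / 4 := by
    have h1 : c' ≤ 1 / (4 * Real.log (Δ + 2)) := min_le_right _ _
    calc c' * Real.log (Δ + 2) ≤ 1 / (4 * Real.log (Δ + 2)) * Real.log (Δ + 2) :=
          mul_le_mul_of_nonneg_right h1 hlog2.le
      _ = 1 / 4 := by field_simp
  set γ : ℝ := μ * c' / 18 with hγ
  have hγ0 : 0 < γ := by rw [hγ]; positivity
  refine ⟨γ, hγ0, ?_⟩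
  -- the conditions that hold for large `n`
  have ev1 : ∀ᶠ k : ℕ in atTop, n₀ ≤ k := eventually_ge_atTop n₀
  have ev0 : ∀ᶠ k : ℕ in atTop, 1 ≤ k := eventually_ge_atTop 1
  have hpow : Tendsto (fun k : ℕ => (k : ℝ) ^ γ) atTop atTop :=
    (tendsto_rpow_atTop hγ0).comp tendsto_natCast_atTop_atTop
  have ev2 : ∀ᶠ k : ℕ in atTop, (2 : ℝ) ≤ (k : ℝ) ^ γ := hpow.eventually_ge_atTop 2
  have hdecay : Tendsto (fun k : ℕ => Real.exp μ * (k : ℝ) ^ (-γ)) atTop (𝓝 (Real.exp μ * 0)) :=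
    ((tendsto_rpow_neg_atTop hγ0).comp tendsto_natCast_atTop_atTop).const_mul _
  rw [mul_zero] at hdecay
  have ev3 : ∀ᶠ k : ℕ in atTop, Real.exp μ * (k : ℝ) ^ (-γ) < μ / 2 :=
    hdecay.eventually (gt_mem_nhds (by positivity))
  obtain ⟨n₁, hn₁⟩ := eventually_atTop.1 (ev1.and (ev0.and (ev2.and ev3)))
  refine ⟨n₁, fun n hn => ?_⟩
  obtain ⟨h₀, h1, h2, h3⟩ := hn₁ n hn
  obtain ⟨E, hE, hloop, hΔ, -, hPD, hgirth, hdens⟩ := hgraphs n h₀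
  have hn' : (0 : ℝ) < n := by exact_mod_cast h1
  -- the `n`-dependent parameters
  set L : ℕ := ⌊c' * Real.log n⌋₊ / 9 with hLdef
  set d : ℕ := ⌊(n : ℝ) ^ γ⌋₊ with hddef
  have hdle : (d : ℝ) ≤ (n : ℝ) ^ γ := Nat.floor_le (by positivity)
  have hd2 : 2 ≤ d := by rw [hddef]; exact Nat.le_floor (by exact_mod_cast h2)
  have h1μ : 0 ≤ 1 - μ := by linarith
  -- `η = (1−µ)^L ≤ e^µ n^{−2γ}` and `d η ≤ µ/2`
  have hηle : (1 - μ) ^ L ≤ Real.exp μ * (n : ℝ) ^ (-(μ * c' / 9)) :=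
    one_sub_pow_L_le hμ0.le hμ1 h1
  have h2γ : -(μ * c' / 9) = -γ + -γ := by rw [hγ]; ring
  have hdη : (d : ℝ) * (1 - μ) ^ L ≤ μ / 2 := by
    calc (d : ℝ) * (1 - μ) ^ L ≤ (n : ℝ) ^ γ * (Real.exp μ * (n : ℝ) ^ (-(μ * c' / 9))) :=
          mul_le_mul hdle hηle (pow_nonneg h1μ L) (by positivity)
      _ = Real.exp μ * (n : ℝ) ^ (-γ) := by
          rw [h2γ, Real.rpow_add hn', Real.rpow_neg hn'.le]
          have : (n : ℝ) ^ γ ≠ 0 := (Real.rpow_pos_of_pos hn' γ).ne'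
          field_simp
      _ ≤ μ / 2 := h3.le
  have hq : (1 - μ) ^ L ≤ 1 / 2 := by
    have : (1 - μ) ^ L ≤ (d : ℝ) * (1 - μ) ^ L := by
      have hd1 : (1 : ℝ) ≤ d := by exact_mod_cast (by omega : 1 ≤ d)
      nlinarith [pow_nonneg h1μ L]
    linarith
  -- the ball fits: `(d (∆+1)^L)² ≤ n`
  have hfit : ((d * (Δ + 1) ^ L : ℕ) : ℝ) ^ 2 ≤ n := by
    have hb : ((Δ + 1 : ℕ) : ℝ) ^ L ≤ (n : ℝ) ^ (1 / 36 : ℝ) := pow_L_le hc'0.le hcΔ h1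
    have hprod : ((d * (Δ + 1) ^ L : ℕ) : ℝ) ≤ (n : ℝ) ^ (γ + 1 / 36) := by
      push_cast
      rw [Real.rpow_add hn']
      exact mul_le_mul hdle (by exact_mod_cast hb) (by positivity) (by positivity)
    have hγsmall : 2 * (γ + 1 / 36) ≤ 1 := by
      have : γ ≤ 1 / 18 := by
        rw [hγ]
        have hc'1 : c' ≤ 1 := by
          have : c' * Real.log (Δ + 2) ≥ c' * Real.log 2 :=
            mul_le_mul_of_nonneg_left (Real.log_le_log (by norm_num)
              (by have := Nat.cast_nonneg (α := ℝ) Δ; linarith)) hc'0.le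
          have hl2 : Real.log 2 > 1 / 2 := by
            have := Real.log_two_gt_d9; linarith
          nlinarith
        nlinarith
      linarith
    calc ((d * (Δ + 1) ^ L : ℕ) : ℝ) ^ 2 ≤ ((n : ℝ) ^ (γ + 1 / 36)) ^ 2 :=
          pow_le_pow_left₀ (Nat.cast_nonneg _) hprod 2
      _ = (n : ℝ) ^ (2 * (γ + 1 / 36)) := by
          rw [← Real.rpow_natCast, ← Real.rpow_mul hn'.le]; ring_nf
      _ ≤ (n : ℝ) ^ (1 : ℝ) := Real.rpow_le_rpow_of_exponent_le (by exact_mod_cast h1) hγsmall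
      _ = n := Real.rpow_one _
  -- path decomposability at length `9L ≤ ⌊c log n⌋`, girth `> 2L`
  have hl : 9 * L ≤ ⌊c * Real.log n⌋₊ := by
    have h9 : 9 * L ≤ ⌊c' * Real.log n⌋₊ := by rw [hLdef]; exact Nat.mul_div_le _ 9
    refine h9.trans (Nat.floor_le_floor ?_)
    exact mul_le_mul_of_nonneg_right hc'c (Real.log_nonneg (by exact_mod_cast h1))
  have hLg : 2 * L < ⌊c * Real.log n⌋₊ + 1 := by omega
  -- enumerate and orient the edges
  classical
  set M : ℕ := E.card with hM
  set eOf : Fin M → Sym2 (Fin n) := fun i => ((E.equivFin.symm i : ↥E) : Sym2 (Fin n)) with heOf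
  have heE : ∀ i, eOf i ∈ E := fun i => (E.equivFin.symm i).2
  set u : Fin M → Fin n := fun i => (Quot.out (eOf i) : Fin n × Fin n).1 with hu
  set v : Fin M → Fin n := fun i => (Quot.out (eOf i) : Fin n × Fin n).2 with hv
  have huv : ∀ i, s(u i, v i) = eOf i := fun i => Quot.out_eq (eOf i)
  have hne : ∀ i, u i ≠ v i := fun i h =>
    hloop _ (heE i) (by rw [← huv i]; exact Sym2.mk_isDiag_iff.2 h)
  refine ⟨M, card_pos.2 hE, u, v, hne, hdens, fun σ => ?_⟩
  -- the edge weights `wt` of the sign pattern `σ`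
  set wt : Sym2 (Fin n) → Bool := fun e => if h : e ∈ E then σ (E.equivFin ⟨e, h⟩) else false with hwt
  have hwti : ∀ i, wt s(u i, v i) = σ i := by
    intro i
    have h1 : wt s(u i, v i) = σ (E.equivFin ⟨s(u i, v i), (huv i).symm ▸ heE i⟩) := by
      rw [hwt]; exact dif_pos _
    rw [h1]
    congr 1
    have h2 : (⟨s(u i, v i), (huv i).symm ▸ heE i⟩ : ↥E) = E.equivFin.symm i := Subtype.ext (huv i)
    rw [h2, Equiv.apply_symm_apply]
  obtain ⟨D, hD, hedges⟩ := exists_pseudoDensity_twoLin_of_gapGraph E hloop hΔ hPD hgirth hμ0.le hμ1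
    hε₁0 hμε hq hl hLg hd2 hdη hfit wt
  refine ⟨D, hD, fun i => ?_⟩
  have h := hedges (u i) (v i) (by rw [huv i]; exact heE i)
  rw [hwti i] at h
  linarith

end Assembly

/-- **CMM09 Theorem 6.1, discharged**: the Sherali–Adams gap for Unique Games
(`CharikarMakarychevMakarychev2009_uniqueGamesSA`) holds unconditionally.
[cite: CharikarMakarychevMakarychev2009, Thm 6.1 (p. 13)] -/
theorem CharikarMakarychevMakarychev2009_uniqueGamesSA_holds :
    CharikarMakarychevMakarychev2009_uniqueGamesSA :=
  CharikarMakarychevMakarychev2009_uniqueGamesSA_of_twoLinAllSigns twoLinAllSigns_of_gapGraphs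

/-- **Lee–Raghavendra–Steurer Theorem 7.6, unconditional** (junta-degree form).
[cite: LeeRaghavendraSteurer2015, Thm 7.6 (arXiv p. 29)] -/
theorem LeeRaghavendraSteurer2015_thm76_holds {t : ℕ} (ht : 1 ≤ t) {δ : ℝ} (hδ : 0 < δ)
    (hδ4 : δ ≤ 1 / 4) :
    ∃ γ : ℝ, 0 < γ ∧ ∃ m₀ : ℕ, ∀ m : ℕ, m₀ ≤ m → ∃ ε : ℝ, 0 < ε ∧
      ∃ I : UGInstance (2 ^ t) m, I.OptLE (1 / 2 ^ t + δ) ∧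
        (m : ℝ) ^ γ < approxJuntaDegree ε (prodWeight (labelWeight (2 ^ t)) m)
          (fun x => 1 - δ - I.val x) :=
  LeeRaghavendraSteurer2015_thm76 CharikarMakarychevMakarychev2009_uniqueGamesSA_holds ht hδ hδ4

/-- **Lee–Raghavendra–Steurer Theorem 7.6 as printed, unconditional.**
[cite: LeeRaghavendraSteurer2015, Thm 7.6 (arXiv p. 29)] -/
theorem LeeRaghavendraSteurer2015_thm76_literal_holds {t : ℕ} (ht : 1 ≤ t) {δ : ℝ} (hδ : 0 < δ)
    (hδ4 : δ ≤ 1 / 4) :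
    ∃ γ ε : ℝ, 0 < γ ∧ 0 < ε ∧ ∃ m : ℕ, 1 ≤ m ∧
      ∃ I : UGInstance (2 ^ t) m, I.OptLE (1 / 2 ^ t + δ) ∧
        (m : ℝ) ^ γ ≤ approxJuntaDegree ε (prodWeight (labelWeight (2 ^ t)) m)
          (fun x => 1 - δ - I.val x) :=
  LeeRaghavendraSteurer2015_thm76_literal CharikarMakarychevMakarychev2009_uniqueGamesSA_holds ht hδ hδ4

/-- **Lee–Raghavendra–Steurer Corollary 7.7, unconditional**: no polynomial-size LP relaxation
(nonnegative factorization of the Unique Games pattern matrix) achieves a `(1 − δ, 1/q + δ)`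
approximation for Unique Games with `q = 2^t` labels. [cite: LeeRaghavendraSteurer2015, Cor 7.7 (arXiv p. 29)] -/
theorem LeeRaghavendraSteurer2015_cor77_holds {t : ℕ} (ht : 1 ≤ t) {δ : ℝ} (hδ : 0 < δ)
    (hδ4 : δ ≤ 1 / 4) (d : ℕ) :
    ∃ c : ℝ, 0 < c ∧ ∀ n : ℕ, 2 ≤ n → ∀ r : ℕ,
      HasNonnegFactorization (ugMatrix (2 ^ t) n (1 - δ) (1 / 2 ^ t + δ)) r → c * (n : ℝ) ^ d ≤ r :=
  LeeRaghavendraSteurer2015_cor77 CharikarMakarychevMakarychev2009_uniqueGamesSA_holds ht hδ hδ4 d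

end Literature.Combinatorics.Optimization

end
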